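import Literature.IUT.HodgeArakelov.MonoThetaSymmetries
import Literature.IUT.HodgeArakelov.MonoThetaProjectiveModelSystem

/-!
# [IUTchII] Rmk. 1.1.1 (ii): NON-VACUITY of `ThetaQuotientData` — the theta quotient `Π_M|_{Π^Θ_Y(M)}` EXISTS at the
# [EtTh] model (and at every level of the natural system of `X̲̲_K`)

Mochizuki, *Inter-universal Teichmüller theory II*, §1, Remark 1.1.1 (ii), kurims manuscript (Dec. 2020) p. 22
[claim: Mochizuki2012, status: disputed] (IUTchII §1 Rmk 1.1.1 (ii), kurims p.22): "by forming the quotient of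
`Π_M` by the restriction of the theta section portion of `M` [cf. [EtTh], Definition 2.13, (ii), (c)] to the subgroup
`Ker(Π_Y(M) ↠ Π^Θ_Y(M)) ⊆ Π_Y(M)`, it makes sense to speak of the quotient `(Π_M ↠) Π_M|_{Π^Θ_Y(M)} (↠ Π^Θ_Y(M))` …
In particular, it makes sense to speak of the subquotient of `Π_M` determined by … `(l·Δ_Θ)(M) ⊆ Π^Θ_Y(M)`."
Record-only vocabulary under the claim key `Mochizuki2012` (D-0012, disputed); abc-iut cell, layer L6,
abc-iut-L6-lead §F v1.18p «NV-L6 WAVE» row **NV-L6/ThetaQuotientData** (seat abc-iut-w4-d030 (gen 2)): a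
NON-VACUITY CERTIFICATE for abc-iut-L6-t1's interface `ThetaQuotientData R` (`MonoThetaSymmetries.lean`, p405104
lineage), over which `TwoSections`, `rigidity_is_difference` (Rmk. 1.1.1 (iii)) and `FlSymmetry` (Rmk. 1.1.1 (iv))
are typed — before this file the tree had NO term of that type (w5-d114 INHABITATION-CENSUS-L6 v3 §A: 0 producers).

WITNESS (GENUINE, label `nonempty_model`): for EVERY mono-theta environment `M` identified with the [EtTh] model
`Π^tp_{Y̲̲}[μ_N] = μ_N ⋊ Π^tp_{Y̲̲}` of abc-iut-L2's rigidity data `R` through one of abc-iut-L6-d6's frames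
(`F : ModelFrame S R`, `e : Π_M ≃ Π^tp_{Y̲̲}[μ_N]`; `F.reconstruction e` = the [IUTchII] Def. 1.1 (i) output, B8 part 5b),
* `kerTheta := Ker(Π^tp_{Y̲̲} → (Π^tp_X)^Θ)` = L2's `R.thetaKer` viewed in `Π_Y(M) = Π^tp_{Y̲̲}` — it IS the bottom of
  the interior cyclotome `(l·Δ_Θ)(M) = (l·Δ_Θ)/thetaKer` (`ModelCyclotomes.intCyc`; `intCyc_bot_eq` by `rfl`);
* `thetaSection := e⁻¹( s^Θ_Ÿ(Ker) )`: on `thetaKer` EVERY theta section `s^Θ_Ÿ` of the collection coincides with the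
  algebraic (tautological) section `s^alg` (L2's `RigidData.cocycle_thetaKer`: "the theta cocycles vanish on
  `Ker(Π^tp_Ÿ ↠ (Π^tp_Ÿ)^Θ)`" — `sTheta_eq_algSection_of_mem_thetaKer`), so the printed "restriction of the theta
  section portion" is the well-defined subgroup `s^alg(thetaKer) = {(1, k) | k ∈ thetaKer}`
  (`map_algSection_thetaKer_eq_map_sTheta`: it IS `s^Θ_Ÿ(thetaKer)` for every `η`);
* it is NORMAL in `Π_M` (`μ_N`-conjugation is trivial on it because `thetaKer ⊆ Ker(aug)` carries the trivial
  cyclotomic character; `thetaKer ⊴ Π^tp_X`) and maps BIJECTIVELY onto `kerTheta` under `Π_M ↠ Π_Y(M)`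
  (the algebraic section splits the projection).
Hence `ModelFrame.thetaQuotientData_nonempty_model` and, at every level `M` of the natural system of `X̲̲_K`
(B8 part 5c, `EtaleLevels.modelRecon`), `EtaleLevels.thetaQuotientData_nonempty_model`. PROOF-ONLY (no
`def`/`instance`/`structure`: the witness is built inside the theorem term). HONEST FRAMING: a kernel fact about
the cell's own model objects; nothing of [IUTchII] is asserted; no side taken on [IUTchIII] Cor. 3.12; typed ≠
discharged; a degenerate witness is NOT used — the frame hypotheses are exactly B8's.
-/

namespace Literature.IUT.HodgeArakelov

open Literature.AnabelianGeometry.EtaleTheta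

universe u

noncomputable section

namespace ModelFrame

open ModelCyclotomes

variable {S : ThetaSetting.{u}} {l : ℕ} {R : RigidData.{u} S.N l}

/-! ### The restricted theta section `s^Θ|_{Ker} = s^alg(thetaKer)` inside `Π^tp_{Y̲̲}[μ_N]` -/

/-- On `thetaKer = Ker(Π^tp_{Y̲̲} → (Π^tp_X)^Θ)` every theta section of the collection IS the algebraic section
(L2 `RigidData.cocycle_thetaKer`). [cite: MochizukiEtTh2009, Def 2.13(ii) p.47] -/
theorem sTheta_eq_algSection_of_mem_thetaKer {η : R.PiYdd → R.mu} (hη : η ∈ R.thetaCocycles)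
    (k : R.PiYdd) (hk : (k : R.PiX) ∈ R.thetaKer) :
    R.toThetaEnvData.sTheta hη k = CycEnvelope.algSection R.augY R.chi (R.toThetaEnvData.inclYdd k) := by
  have h1 : η k = 1 := R.cocycle_thetaKer η hη k hk
  ext
  · change (η k)⁻¹ = (SemidirectProduct.inr (R.toThetaEnvData.inclYdd k) : R.env).left
    rw [h1, inv_one, SemidirectProduct.left_inr]
  · rfl

/-- Membership in `s^alg(thetaKer) ⊆ μ_N ⋊ Π^tp_{Y̲̲}`: cyclotome component `1`, group component in `thetaKer`.
[claim: Mochizuki2012, status: disputed] (IUTchII §1 Rmk 1.1.1 (ii), kurims p.22) -/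
theorem mem_map_algSection_thetaKer_iff (x : R.env) :
    x ∈ (R.thetaKer.subgroupOf R.PiY).map (CycEnvelope.algSection R.augY R.chi) ↔
      x.left = 1 ∧ ((x.right : R.PiY) : R.PiX) ∈ R.thetaKer := by
  constructor
  · rintro ⟨k, hk, rfl⟩
    exact ⟨SemidirectProduct.left_inr k, Subgroup.mem_subgroupOf.1 hk⟩
  · rintro ⟨h1, hk⟩
    refine ⟨x.right, Subgroup.mem_subgroupOf.2 hk, ?_⟩
    ext
    · rw [SemidirectProduct.left_inr, h1]
    · rw [SemidirectProduct.right_inr]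

/-- `s^alg(thetaKer)` IS `s^Θ_Ÿ(thetaKer)` for EVERY theta cocycle `η` of the collection (the printed "restriction of
the theta section portion of `M` to `Ker(Π_Y(M) ↠ Π^Θ_Y(M))`" is independent of the choice within `η̈^{Θ,l·ℤ×μ_2}`).
[claim: Mochizuki2012, status: disputed] (IUTchII §1 Rmk 1.1.1 (ii), kurims p.22) -/
theorem map_algSection_thetaKer_eq_map_sTheta {η : R.PiYdd → R.mu} (hη : η ∈ R.thetaCocycles) :
    (R.thetaKer.subgroupOf R.PiY).map (CycEnvelope.algSection R.augY R.chi) =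
      (R.thetaKer.subgroupOf R.PiYdd).map (R.toThetaEnvData.sTheta hη) := by
  ext x
  constructor
  · rintro ⟨k, hk, rfl⟩
    have hk' : (k : R.PiX) ∈ R.thetaKer := Subgroup.mem_subgroupOf.1 hk
    refine ⟨⟨(k : R.PiX), (R.thetaKer_le hk').1⟩, Subgroup.mem_subgroupOf.2 hk', ?_⟩
    rw [sTheta_eq_algSection_of_mem_thetaKer hη _ hk']
    rfl
  · rintro ⟨k, hk, rfl⟩
    have hk' : (k : R.PiX) ∈ R.thetaKer := Subgroup.mem_subgroupOf.1 hk
    refine ⟨R.toThetaEnvData.inclYdd k, Subgroup.mem_subgroupOf.2 hk', ?_⟩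
    rw [sTheta_eq_algSection_of_mem_thetaKer hη _ hk']

/-- Conjugates of elements of `thetaKer` (inside `Π^tp_{Y̲̲}`) stay in `thetaKer` and are killed by the augmentation.
[cite: MochizukiEtTh2009, Cor 2.18 p.59] -/
theorem augY_conj_eq_one_of_mem_thetaKer (y k : R.PiY) (hk : ((k : R.PiY) : R.PiX) ∈ R.thetaKer) :
    (((y * k * y⁻¹ : R.PiY) : R.PiX) ∈ R.thetaKer) ∧ R.augY (y * k * y⁻¹) = 1 := by
  have hconj : ((y * k * y⁻¹ : R.PiY) : R.PiX) ∈ R.thetaKer := by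
    rw [Subgroup.coe_mul, Subgroup.coe_mul, Subgroup.coe_inv]
    exact R.thetaKer_normal.conj_mem _ hk _
  exact ⟨hconj, (R.thetaKer_le hconj).2⟩

/-- `s^alg(thetaKer)` is NORMAL in `Π^tp_{Y̲̲}[μ_N]`: conjugation by `(a, y)` sends `(1, k)` to
`(a · χ(aug(yky⁻¹))(a⁻¹), yky⁻¹) = (1, yky⁻¹)` since `thetaKer ⊆ Ker(aug)`.
[claim: Mochizuki2012, status: disputed] (IUTchII §1 Rmk 1.1.1 (ii), kurims p.22) -/
theorem map_algSection_thetaKer_normal :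
    ((R.thetaKer.subgroupOf R.PiY).map (CycEnvelope.algSection R.augY R.chi)).Normal := by
  refine ⟨fun n hn x => ?_⟩
  rw [mem_map_algSection_thetaKer_iff] at hn ⊢
  obtain ⟨hn1, hnK⟩ := hn
  obtain ⟨hconj, haug⟩ := augY_conj_eq_one_of_mem_thetaKer x.right n.right hnK
  have hright : (x * n * x⁻¹).right = x.right * n.right * x.right⁻¹ := by
    rw [SemidirectProduct.mul_right, SemidirectProduct.mul_right, SemidirectProduct.inv_right]
  refine ⟨?_, by rw [hright]; exact hconj⟩
  have hφ : (R.chi.comp R.augY) (x.right * n.right * x.right⁻¹) = 1 := by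
    rw [MonoidHom.comp_apply, haug, map_one]
  rw [SemidirectProduct.mul_left, SemidirectProduct.mul_left, SemidirectProduct.inv_left,
    SemidirectProduct.mul_right, hn1, map_one, mul_one, ← MulAut.mul_apply, ← map_mul]
  rw [hφ, MulAut.one_apply, mul_inv_cancel]

/-! ### The witness -/

/-- **NON-VACUITY of `ThetaQuotientData` at the [EtTh] model (GENUINE witness)**: for every frame `F : ModelFrame S R`
and identification `e : Π_M ≃ Π^tp_{Y̲̲}[μ_N]`, the Def. 1.1 (i) output `F.reconstruction e` carries the theta-quotient
data of Rmk. 1.1.1 (ii): `kerTheta := thetaKer` (= the bottom of `(l·Δ_Θ)(M)`, `rfl`), `thetaSection := e⁻¹(s^Θ|_{Ker})`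
— normal, mapping bijectively onto `kerTheta`. [claim: Mochizuki2012, status: disputed] (IUTchII §1 Rmk 1.1.1 (ii), kurims p.22) -/
theorem thetaQuotientData_nonempty_model (F : ModelFrame S R) {M : MonoThetaEnv S} (e : M.Pi ≃ₜ* R.env) :
    Nonempty (ThetaQuotientData (F.reconstruction e)) := by
  haveI hN := map_algSection_thetaKer_normal (R := R)
  refine ⟨{ kerTheta := R.thetaKer.subgroupOf R.PiY
            kerTheta_normal := inferInstance
            thetaSection := ((R.thetaKer.subgroupOf R.PiY).map
              (CycEnvelope.algSection R.augY R.chi)).comap e.toMulEquiv.toMonoidHom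
            thetaSection_normal := Subgroup.Normal.comap hN _
            thetaSection_bijOn := ?_
            intCyc_bot_eq := rfl }⟩
  refine ⟨?_, ?_, ?_⟩
  · -- maps to
    intro x hx
    rw [Subgroup.coe_comap, Set.mem_preimage, SetLike.mem_coe, mem_map_algSection_thetaKer_iff] at hx
    exact Subgroup.mem_subgroupOf.2 hx.2
  · -- injective on
    intro x hx y hy hxy
    rw [Subgroup.coe_comap, Set.mem_preimage, SetLike.mem_coe, mem_map_algSection_thetaKer_iff] at hx hy
    apply e.injective
    have hx1 : (e x).left = 1 := hx.1
    have hy1 : (e y).left = 1 := hy.1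
    have h2 : (e x).right = (e y).right := hxy
    exact SemidirectProduct.ext (hx1.trans hy1.symm) h2
  · -- surjective on
    intro k hk
    refine ⟨e.symm (CycEnvelope.algSection R.augY R.chi k), ?_, ?_⟩
    · rw [Subgroup.coe_comap, Set.mem_preimage, SetLike.mem_coe]
      change e.toMulEquiv (e.symm _) ∈ _
      rw [show e.toMulEquiv (e.symm (CycEnvelope.algSection R.augY R.chi k)) =
        CycEnvelope.algSection R.augY R.chi k from e.apply_symm_apply _]
      exact ⟨k, hk, rfl⟩
    · change (CycEnvelope.proj R.augY R.chi) (e.toMulEquiv (e.symm _)) = k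
      rw [show e.toMulEquiv (e.symm (CycEnvelope.algSection R.augY R.chi k)) =
        CycEnvelope.algSection R.augY R.chi k from e.apply_symm_apply _]
      rfl

end ModelFrame

/-! ### At every level of the natural system of `X̲̲_K` (B8 part 5c) -/

namespace EtaleLevels

open Literature.AnabelianGeometry.SemiGraphs
open scoped Literature.AnabelianGeometry.EtaleTheta

variable {p : ℕ} [Fact p.Prime] {D : Literature.AnabelianGeometry.EtaleTheta.ThetaSetting p}
  {E : D.EtaleThetaData} {l : ℕ} (C : E.DoubleUnderline l) (hC : D.Compat) (hS : D.Sec2Hyps)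
  (hl : l.Prime) (hp2 : p ≠ 2) (hpl : p ≠ l) (hζ : ∃ ζ : D.K, IsPrimitiveRoot ζ (4 * l))
  (mods : ∀ M : ℕ+, D.CyclotomeMod l M)
  (f : contCocycles D.toTheta D.DeltaTheta C.GtpYdduu) (hf : f ∈ C.rootCocycles hC)
  (h15 : Literature.AnabelianGeometry.EtaleTheta.ThetaSetting.Prop15iii E hC) (L : C.CuspLabels)
  (hZ : ∀ M : ℕ+, Nonempty (ModelCyclotomes.lDeltaQuot (C.rigidData (mods M) hC hS h15 L) ≃*
    Literature.IUT.HodgeTheaters.ZHat))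

/-- **NON-VACUITY of `ThetaQuotientData` at the GENUINE natural system**: at every level `M ∈ ℕ_{≥1}`, the Def. 1.1 (i)
output `Π_X(𝕄_M) = Π^tp_{X̲̲}`, `Π_Y(𝕄_M) = Π^tp_{Y̲̲}` of the model mono-theta environment `𝕄_M` of `X̲̲_K`
(`EtaleLevels.modelRecon`, the identity frame) carries the Rmk. 1.1.1 (ii) theta-quotient data.
[claim: Mochizuki2012, status: disputed] (IUTchII §1 Rmk 1.1.1 (ii), kurims p.22) -/
theorem thetaQuotientData_nonempty_model (M : ℕ+) :
    Nonempty (ThetaQuotientData (modelRecon C hC hS hl hp2 hpl hζ mods f hf h15 L hZ M)) := by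
  unfold modelRecon
  exact ModelFrame.thetaQuotientData_nonempty_model
    (modelFrame C hC hS hl hp2 hpl hζ mods f hf h15 L hZ M) _

end EtaleLevels

end

end Literature.IUT.HodgeArakelov

/-! ## v2 (append-only): the witness WITH ITS DEFINING EQUATIONS, and `Π_μ(M) ∩ s^Θ|_{Ker} = 1`

For consumers that must refer to the fields of the witness (e.g. abc-iut-L6-t1's `TwoSections T W` of Rmk. 1.1.1 (iii),
whose field `extCyc_inf_bot : R.extCyc ⊓ T.thetaSection = ⊥` is a property of `(R, T)` alone — abc-iut-w5-d225's NV-L6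
analysis 03:29:06Z): an `∃`-form naming `kerTheta`, `thetaSection` by equations, together with the kernel fact that the
exterior cyclotome `Π_μ(M) = Ker(Π_M ↠ Π_Y(M))` meets the restricted theta section trivially (`μ_N × 1` ∩ `1 × thetaKer`
inside `μ_N ⋊ Π^tp_{Y̲̲}`). Still PROOF-ONLY. -/

namespace Literature.IUT.HodgeArakelov

open Literature.AnabelianGeometry.EtaleTheta

universe u

noncomputable section

namespace ModelFrame

variable {S : ThetaSetting.{u}} {l : ℕ} {R : RigidData.{u} S.N l}

/-- `Π_M ↠ Π_Y(M)` restricted to `e⁻¹(s^alg(thetaKer))` is a BIJECTION onto `thetaKer` (the algebraic section splits the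
projection; cyclotome components are `1`). [claim: Mochizuki2012, status: disputed] (IUTchII §1 Rmk 1.1.1 (ii), kurims p.22) -/
theorem bijOn_projY_comap_algSection_thetaKer (F : ModelFrame S R) {M : MonoThetaEnv S} (e : M.Pi ≃ₜ* R.env) :
    Set.BijOn (F.reconstruction e).projY
      (((R.thetaKer.subgroupOf R.PiY).map (CycEnvelope.algSection R.augY R.chi)).comap e.toMulEquiv.toMonoidHom :
        Subgroup M.Pi)
      (R.thetaKer.subgroupOf R.PiY) := by
  refine ⟨?_, ?_, ?_⟩
  · intro x hx
    rw [Subgroup.coe_comap, Set.mem_preimage, SetLike.mem_coe, mem_map_algSection_thetaKer_iff] at hx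
    exact Subgroup.mem_subgroupOf.2 hx.2
  · intro x hx y hy hxy
    rw [Subgroup.coe_comap, Set.mem_preimage, SetLike.mem_coe, mem_map_algSection_thetaKer_iff] at hx hy
    apply e.injective
    have hx1 : (e x).left = 1 := hx.1
    have hy1 : (e y).left = 1 := hy.1
    have h2 : (e x).right = (e y).right := hxy
    exact SemidirectProduct.ext (hx1.trans hy1.symm) h2
  · intro k hk
    refine ⟨e.symm (CycEnvelope.algSection R.augY R.chi k), ?_, ?_⟩
    · rw [Subgroup.coe_comap, Set.mem_preimage, SetLike.mem_coe]
      change e.toMulEquiv (e.symm _) ∈ _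
      rw [show e.toMulEquiv (e.symm (CycEnvelope.algSection R.augY R.chi k)) =
        CycEnvelope.algSection R.augY R.chi k from e.apply_symm_apply _]
      exact ⟨k, hk, rfl⟩
    · change (CycEnvelope.proj R.augY R.chi) (e.toMulEquiv (e.symm _)) = k
      rw [show e.toMulEquiv (e.symm (CycEnvelope.algSection R.augY R.chi k)) =
        CycEnvelope.algSection R.augY R.chi k from e.apply_symm_apply _]
      rfl

/-- **`Π_μ(M) ∩ s^Θ|_{Ker} = 1`**: the exterior cyclotome `Π_μ(M) = Ker(Π_M ↠ Π_Y(M))` (= `e⁻¹(μ_N × 1)`) meets the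
restricted theta section `e⁻¹(s^alg(thetaKer)) = e⁻¹(1 × thetaKer)` trivially — the field `TwoSections.extCyc_inf_bot` of
Rmk. 1.1.1 (iii) ("`Π_μ(M) ↪ Π_M|_{(l·Δ_Θ)}` is injective") for this witness.
[claim: Mochizuki2012, status: disputed] (IUTchII §1 Rmk 1.1.1 (iii), kurims p.22) -/
theorem extCyc_inf_comap_algSection_thetaKer_eq_bot (F : ModelFrame S R) {M : MonoThetaEnv S}
    (e : M.Pi ≃ₜ* R.env) :
    (F.reconstruction e).extCyc ⊓
        ((R.thetaKer.subgroupOf R.PiY).map (CycEnvelope.algSection R.augY R.chi)).comap e.toMulEquiv.toMonoidHom =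
      ⊥ := by
  rw [eq_bot_iff]
  intro x hx
  obtain ⟨hker, hsec⟩ := Subgroup.mem_inf.1 hx
  have hsec' := (mem_map_algSection_thetaKer_iff _).1 (Subgroup.mem_comap.1 hsec)
  have h1 : (e x).right = 1 := hker
  have h2 : (e x).left = 1 := hsec'.1
  have h3 : e x = 1 := SemidirectProduct.ext h2 h1
  rw [Subgroup.mem_bot]
  exact e.injective (h3.trans (map_one e).symm)

/-- **NON-VACUITY of `ThetaQuotientData`, `∃`-form WITH DEFINING EQUATIONS** (GENUINE witness, same as
`thetaQuotientData_nonempty_model`): `kerTheta = thetaKer`, `thetaSection = e⁻¹(s^alg(thetaKer))` (= `e⁻¹(s^Θ_Ÿ(thetaKer))`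
for every theta cocycle, `map_algSection_thetaKer_eq_map_sTheta`), and `Π_μ(M) ∩ thetaSection = 1`.
[claim: Mochizuki2012, status: disputed] (IUTchII §1 Rmk 1.1.1 (ii), kurims p.22) -/
theorem exists_thetaQuotientData_model (F : ModelFrame S R) {M : MonoThetaEnv S} (e : M.Pi ≃ₜ* R.env) :
    ∃ T : ThetaQuotientData (F.reconstruction e),
      T.kerTheta = R.thetaKer.subgroupOf R.PiY ∧
      T.thetaSection =
        ((R.thetaKer.subgroupOf R.PiY).map (CycEnvelope.algSection R.augY R.chi)).comap e.toMulEquiv.toMonoidHom ∧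
      (F.reconstruction e).extCyc ⊓ T.thetaSection = ⊥ := by
  haveI hN := map_algSection_thetaKer_normal (R := R)
  exact ⟨{ kerTheta := R.thetaKer.subgroupOf R.PiY
           kerTheta_normal := inferInstance
           thetaSection := ((R.thetaKer.subgroupOf R.PiY).map
             (CycEnvelope.algSection R.augY R.chi)).comap e.toMulEquiv.toMonoidHom
           thetaSection_normal := Subgroup.Normal.comap hN _
           thetaSection_bijOn := bijOn_projY_comap_algSection_thetaKer F e
           intCyc_bot_eq := rfl },
    rfl, rfl, extCyc_inf_comap_algSection_thetaKer_eq_bot F e⟩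

end ModelFrame

namespace EtaleLevels

open Literature.AnabelianGeometry.SemiGraphs
open scoped Literature.AnabelianGeometry.EtaleTheta

variable {p : ℕ} [Fact p.Prime] {D : Literature.AnabelianGeometry.EtaleTheta.ThetaSetting p}
  {E : D.EtaleThetaData} {l : ℕ} (C : E.DoubleUnderline l) (hC : D.Compat) (hS : D.Sec2Hyps)
  (hl : l.Prime) (hp2 : p ≠ 2) (hpl : p ≠ l) (hζ : ∃ ζ : D.K, IsPrimitiveRoot ζ (4 * l))
  (mods : ∀ M : ℕ+, D.CyclotomeMod l M)
  (f : contCocycles D.toTheta D.DeltaTheta C.GtpYdduu) (hf : f ∈ C.rootCocycles hC)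
  (h15 : Literature.AnabelianGeometry.EtaleTheta.ThetaSetting.Prop15iii E hC) (L : C.CuspLabels)
  (hZ : ∀ M : ℕ+, Nonempty (ModelCyclotomes.lDeltaQuot (C.rigidData (mods M) hC hS h15 L) ≃*
    Literature.IUT.HodgeTheaters.ZHat))

/-- The `∃`-form with defining equations at every level `M` of the natural system of `X̲̲_K` (identity frame).
[claim: Mochizuki2012, status: disputed] (IUTchII §1 Rmk 1.1.1 (ii), kurims p.22) -/
theorem exists_thetaQuotientData_model (M : ℕ+) :
    ∃ T : ThetaQuotientData (modelRecon C hC hS hl hp2 hpl hζ mods f hf h15 L hZ M),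
      T.kerTheta = (C.rigidData (mods M) hC hS h15 L).thetaKer.subgroupOf (C.rigidData (mods M) hC hS h15 L).PiY ∧
      T.thetaSection =
        (((C.rigidData (mods M) hC hS h15 L).thetaKer.subgroupOf (C.rigidData (mods M) hC hS h15 L).PiY).map
          (CycEnvelope.algSection (C.rigidData (mods M) hC hS h15 L).augY (C.rigidData (mods M) hC hS h15 L).chi)).comap
          (ContinuousMulEquiv.refl _).toMulEquiv.toMonoidHom ∧
      (modelRecon C hC hS hl hp2 hpl hζ mods f hf h15 L hZ M).extCyc ⊓ T.thetaSection = ⊥ := by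
  unfold modelRecon
  exact ModelFrame.exists_thetaQuotientData_model
    (modelFrame C hC hS hl hp2 hpl hζ mods f hf h15 L hZ M) _

end EtaleLevels

end

end Literature.IUT.HodgeArakelov
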